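import Summits.SmoothPoincare4.SmoothPoincare4.Theses.EinsteinBulk
import Summits.SmoothPoincare4.SmoothPoincare4.Theses.RicciTranscript

/-!
# Crux `EinsteinBulk.YamabeExtremalSpheres` (item stmt-SmoothPoincare4-7998, "Y1") — birth skeleton
# `presentation-surgery`: Y1 ⇐ every homotopy 4-sphere is a PRESENTATION sphere (item 3720, shared)
#                          ∧ presentation spheres are Yamabe-EXTREMAL (surgery transport of σ = σ₄)

Filed by the crux-strategist of `InformationMetricHadamard.AhHadamardFilling` (stmt-SmoothPoincare4-6014,
BC2 redirect: Y1 is piece X₁ of the route-level split of that crux) as the PLAN for this open piece. It is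
the attack on Y1 recorded in card `yamabe-extremal-or-thin` (cruxes (3)–(4)), typed over the tree:

* TOPOLOGY, by name: `RicciTranscript.PresentationSphere` (item stmt-SmoothPoincare4-3720, =
  `EntropyLadder.BoundsContractibleTwoHandlebody`; rank-2 crux of route `RicciTranscript`): every closed
  smooth `M ≃ₕ S⁴` bounds a compact contractible smooth 5-manifold with an adapted Morse function all of
  whose critical points have index `≤ 2` — `M = ∂(B⁵ ∪ k 1-handles ∪ k 2-handles)`, i.e. `M` is obtained
  from `#ᵏ(S¹ × S³)` by `k` circle surgeries (the 2-handles), all SPIN-framed (they sit in a contractible,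
  hence spin, 5-manifold).
* CONFORMAL ANALYSIS, new stub `stub_presentationSpheresExtremal`: the boundary of such a 5-manifold is
  Yamabe-extremal, `σ(M) = σ(S⁴) = 8√6π` (metric form of the item). Intended proof: `σ(#ᵏ S¹×S³) = σ₄`
  (Kobayashi 1987 + Schoen 1989) and extremality is transported through each spin circle surgery — the
  SHARP spin circle-surgery constant `Λ♯_spin = σ₄` (Ammann–Dahl–Humbert 2013 give `Λ_{4,1} > 0` only;
  the model necks are `ℍ²_c × S²`, `c = 1` conformally `S⁴ ∖ S¹`). The two framings of a circle
  surgery on the unknot `S¹ ⊂ S⁴` give `S² × S²` (spin) and `CP² # −CP²` (twisted); a sharp constant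
  `Λ♯ = σ₄` for either framing would force `σ(S² × S²) = σ₄`, resp. `σ(CP² # −CP²) = σ₄` — both
  UNDECIDED (ADH 2013 p. 5: "the value of σ(S²×S²) is not known"; the Gursky–LeBrun Seiberg–Witten
  upper bound `4π√(2(2χ+3τ))` — `12√2π` for `CP²`, where LeBrun's perturbation trick proves it; it
  would read `16π` here — is NOT available for these `b⁻ = 1` manifolds, and `16π` is only the Yamabe
  constant of the product class on `S² × S²`, a lower bound). So `σ(S² × S²)` (equivalently the model-neck constant `Λ_{4,1}♯`) is the
  cheapest falsifier of this stub; the stub keeps `W` CONTRACTIBLE (spin, homology-sphere boundaries).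

`YamabeExtremalSpheres_of` is modus ponens (honest trivial seam: the two pieces are a topological and
an analytic statement with disjoint literatures). Relation to other items: the new stub is implied by
`PresentationSpheresStandard` (item 3717, RicciTranscript/EntropyLadder/ConvexityLadder: presentation
spheres are standard) together with Aubin–Schoen (`S⁴` is extremal), but not conversely (extremal ⇏
standard unless the supremum is attained): it is a strictly weaker target with its own mechanism.
-/

noncomputable section

-- the prescribed namespace `Summit.<P>.<Sub>.…` duplicates `SmoothPoincare4` (P = Sub)
set_option linter.dupNamespace false

open scoped Manifold ContDiff Topology ContinuousMap
open Set Function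
open Literature.Geometry.Lorentzian
open Summit.SmoothPoincare4.SmoothPoincare4.Theses

namespace Summit.SmoothPoincare4.SmoothPoincare4.Cruxes.YamabeExtremalSpheres.PresentationSurgery

/-- **Stub — presentation spheres are Yamabe-extremal.** A closed smooth 4-manifold `M` (with its Borel
σ-algebra, as in the item) that bounds a compact CONTRACTIBLE smooth 5-manifold `W` carrying a Morse
function adapted to `∂W` all of whose critical points have index `≤ 2` (the conclusion of
`RicciTranscript.PresentationSphere`, verbatim) is Yamabe-extremal: for every `η > 0` there is a metric
`g₀` with `∫_M R_h dV_h ≥ (1−η)·8√6π·√Vol(M,h)` for every metric `h` conformal to `g₀` (the conclusion of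
`EinsteinBulk.YamabeExtremalSpheres`, verbatim). Why plausibly true: such `M` is `#ᵏ(S¹×S³)` (σ = σ₄,
Kobayashi–Schoen) modified by `k` spin-framed circle surgeries, and the surgery-monotonicity theory of the
Yamabe invariant (Kobayashi 1987, Petean–Yun 1999, Ammann–Dahl–Humbert 2013) controls σ from below under
codimension-3 surgery up to a dimensional constant `Λ_{4,1}` (numerically `59.4… < σ₄ = 61.5…`, ADH
§1); the stub is the sharp form `Λ♯ = σ₄` for the surgeries occurring in contractible 2-handlebodies.
Why it might fail: `σ(S² × S²) < σ₄` (0-framed surgery on the unknot in `S⁴`; value unknown) would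
refute the sharp constant for non-contractible `W` and strongly suggests failure here too;
contractibility of `W` excludes `S² × S²` itself as a conclusion but not necks of the same local model.
[cite: Kobayashi1987] [cite: Schoen1989] [cite: AmmannDahlHumbert2013, Thm 1.3, Cor 1.4] [cite: PeteanYun1999] -/
theorem stub_presentationSpheresExtremal
    (M : Type) [TopologicalSpace M] [T2Space M] [SecondCountableTopology M]
    [ChartedSpace (EuclideanSpace ℝ (Fin 4)) M] [IsManifold (𝓡 4) ∞ M] [CompactSpace M]
    [MeasurableSpace M] [BorelSpace M]
    (hW : ∃ (W : Type) (_ : TopologicalSpace W) (_ : T2Space W) (_ : SecondCountableTopology W)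
      (_ : ChartedSpace (EuclideanHalfSpace (4 + 1)) W) (_ : IsManifold (𝓡∂ (4 + 1)) ∞ W)
      (_ : CompactSpace W), ContractibleSpace W ∧
      (∃ f : W → ℝ, Literature.Topology.FourManifolds.IsMorseAdapted (𝓡∂ (4 + 1)) f ∧
        ∀ z, Literature.Topology.FourManifolds.IsMCriticalPt (𝓡∂ (4 + 1)) f z →
          Literature.Topology.FourManifolds.morseIndex (𝓡∂ (4 + 1)) f z ≤ 2) ∧
      ∃ φ : M → W, Manifold.IsSmoothEmbedding (𝓡 4) (𝓡∂ (4 + 1)) ∞ φ ∧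
        Set.range φ = (𝓡∂ (4 + 1)).boundary W)
    (η : ℝ) (hη : 0 < η) :
    ∃ g₀ : Bundle.ContMDiffRiemannianMetric (𝓡 4) ∞ (EuclideanSpace ℝ (Fin 4))
      (TangentSpace (𝓡 4) : M → Type _),
      ∀ (h' : Bundle.ContMDiffRiemannianMetric (𝓡 4) ∞ (EuclideanSpace ℝ (Fin 4))
          (TangentSpace (𝓡 4) : M → Type _)) [(PseudoRiemannianMetric.ofRiemannian h').HasLeviCivita],
        (∃ φ : M → ℝ, ∀ x : M, 0 < φ x ∧ ∀ v w : TangentSpace (𝓡 4) x,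
            h'.inner x v w = φ x * g₀.inner x v w) →
          (1 - η) * (8 * Real.sqrt 6 * Real.pi) *
              Real.sqrt ((riemannianMeasure h' Set.univ).toReal) ≤
            ∫ x, (PseudoRiemannianMetric.ofRiemannian h').scalarCurvature x ∂(riemannianMeasure h') := by
  sorry

/-- **Stub — every homotopy 4-sphere is a presentation sphere**, BY NAME: the shared item
`RicciTranscript.PresentationSphere` (stmt-SmoothPoincare4-3720; also
`EntropyLadder.BoundsContractibleTwoHandlebody`). Registered here as a stub of this line so that the
line's dependence on it is explicit; it is proved (or refuted) THERE. [cite: AndrewsCurtis1965]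
[cite: AkbulutKirby1985, §1] -/
theorem stub_presentationSphere : RicciTranscript.PresentationSphere := by
  sorry

/-- **THE SKELETON THEOREM: Y1 BY NAME from the shared item `RicciTranscript.PresentationSphere`
(stmt-SmoothPoincare4-3720, a registered obligation, as hypothesis) and the registered stub
`stub_presentationSpheresExtremal` (inside)** — modus ponens (`trivial_seam`). -/
theorem YamabeExtremalSpheres_of (h1 : RicciTranscript.PresentationSphere) :
    EinsteinBulk.YamabeExtremalSpheres := by
  intro M _ _ _ _ _ _ _ _ he η hη
  exact stub_presentationSpheresExtremal M (h1 M he) η hη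

/-- Y1 from the two registered stubs alone (the topological one is item 3720, proved or refuted THERE). -/
theorem yamabeExtremalSpheres_of_stubs : EinsteinBulk.YamabeExtremalSpheres :=
  YamabeExtremalSpheres_of stub_presentationSphere

/-! ## The typed implication `PresentationSphere → PresentationSpheresExtremal → Y1` (documentation) -/

/-- Statement of `stub_presentationSpheresExtremal`. -/
def PresentationSpheresExtremalStmt : Prop :=
  ∀ (M : Type) [TopologicalSpace M] [T2Space M] [SecondCountableTopology M]
    [ChartedSpace (EuclideanSpace ℝ (Fin 4)) M] [IsManifold (𝓡 4) ∞ M] [CompactSpace M]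
    [MeasurableSpace M] [BorelSpace M],
    (∃ (W : Type) (_ : TopologicalSpace W) (_ : T2Space W) (_ : SecondCountableTopology W)
      (_ : ChartedSpace (EuclideanHalfSpace (4 + 1)) W) (_ : IsManifold (𝓡∂ (4 + 1)) ∞ W)
      (_ : CompactSpace W), ContractibleSpace W ∧
      (∃ f : W → ℝ, Literature.Topology.FourManifolds.IsMorseAdapted (𝓡∂ (4 + 1)) f ∧
        ∀ z, Literature.Topology.FourManifolds.IsMCriticalPt (𝓡∂ (4 + 1)) f z →
          Literature.Topology.FourManifolds.morseIndex (𝓡∂ (4 + 1)) f z ≤ 2) ∧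
      ∃ φ : M → W, Manifold.IsSmoothEmbedding (𝓡 4) (𝓡∂ (4 + 1)) ∞ φ ∧
        Set.range φ = (𝓡∂ (4 + 1)).boundary W) →
    ∀ η : ℝ, 0 < η →
    ∃ g₀ : Bundle.ContMDiffRiemannianMetric (𝓡 4) ∞ (EuclideanSpace ℝ (Fin 4))
      (TangentSpace (𝓡 4) : M → Type _),
      ∀ (h' : Bundle.ContMDiffRiemannianMetric (𝓡 4) ∞ (EuclideanSpace ℝ (Fin 4))
          (TangentSpace (𝓡 4) : M → Type _)) [(PseudoRiemannianMetric.ofRiemannian h').HasLeviCivita],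
        (∃ φ : M → ℝ, ∀ x : M, 0 < φ x ∧ ∀ v w : TangentSpace (𝓡 4) x,
            h'.inner x v w = φ x * g₀.inner x v w) →
          (1 - η) * (8 * Real.sqrt 6 * Real.pi) *
              Real.sqrt ((riemannianMeasure h' Set.univ).toReal) ≤
            ∫ x, (PseudoRiemannianMetric.ofRiemannian h').scalarCurvature x ∂(riemannianMeasure h')

/-- The typed implication: `PresentationSphere → PresentationSpheresExtremalStmt → Y1`. -/
theorem YamabeExtremalSpheres_of_stmts (h1 : RicciTranscript.PresentationSphere)
    (h2 : PresentationSpheresExtremalStmt) : EinsteinBulk.YamabeExtremalSpheres := by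
  intro M _ _ _ _ _ _ _ _ he η hη
  exact h2 M (h1 M he) η hη

end Summit.SmoothPoincare4.SmoothPoincare4.Cruxes.YamabeExtremalSpheres.PresentationSurgery

end
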